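import Summits.QuantumFields.BalabanUV.Beta.VertexToriSymmetry

/-!
# Beta / VertexToriSymmetryEnds — the transports available today (scalar and matrix families) and the binder-shaped ENDs of
# `Beta/VertexToriSymmetry` (β sub-cell, BINDER-OWNERS row CAP-k, lineage `b2b-balaban-beta-an5`, gen 22; node BETA-an5-g22-TORI-SYMMETRY)

`Beta/VertexToriSymmetry` reduces a pointwise predicate `P` on the vertex tori to a fundamental region, given transport hypotheses
`P q → P (τ q)` along the symmetry maps `τ` (coordinate reflections, negation, `conjNeg`, permutations).  This module supplies the transports
that the tree can discharge TODAY and the ENDs in binder shape: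

* §1 scalar integrands `G : ℂ^{d+1} → E`: reflection ∕ permutation INVARIANCE hypotheses and evenness `G (−q) = G q` transport norm bounds and
  zero-freeness; `ConjSymm G` (`Beta/ConjReflectionAlgebra`, kernel for the one-loop algebra over self-conjugate tables) transports norm bounds
  (`‖conj z‖ = ‖z‖`) AND zero-freeness along `conjNeg`; ENDs `norm_le_vertexTori_of_plusTorus` (reflections in every direction: the ONE all-plus
  torus suffices), `norm_le_vertexTori_of_halfPlusTorus` (+ `ConjSymm`: HALF of it, `Re q_{ν₀} ≤ 0`), `TubeHol.norm_le_of_plusTorus`,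
  `TubeHol.stripRegularC_of_plusTorus`, `TubeHol.stripRegularC_of_capRegion` (cap3's (P)(R)(C) region).
* §2 matrix families in the EUCLIDEAN OPERATOR NORM (route A's `hBa : ‖(A q)⁻¹‖ ≤ B`): `l2_opNorm_map_conj` (`‖A.map conj‖₂ = ‖A‖₂`, by the
  conjugate-linear isometry `v ↦ v̄` of `ℂⁿ`), `l2_opNorm_transpose` (`‖Aᵀ‖₂ = ‖A‖₂`); hence `MatConjSymm A` ⟹ `‖A (conjNeg q)‖ = ‖A q‖` and
  `‖(A (conjNeg q))⁻¹‖ = ‖(A q)⁻¹‖` (the `conjNeg` transport of `hBa` — dischargeable today), and the TABLE SYMMETRY `K[−R] = K[R]ᵀ` of a stencil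
  family over a symmetric offset set (the property cap4's Lemma G5 tool verified for `K₀`'s 21 offset tables — a finite check OUTSIDE the kernel,
  here a hypothesis) ⟹ `MatNegTranspose A : A (−q) = (A q)ᵀ` ⟹ `‖(A (−q))⁻¹‖ = ‖(A q)⁻¹‖` (the negation transport of `hBa`: sign patterns `s`
  and `−s` identified) and evenness of the tadpole trace `tr((A q)⁻¹ B q)`.

HONEST FRAMING.  Kernel glue ([folklore] linear algebra): no symmetry of the cell's actual SU(2) δ-axial tables is asserted (hypotheses); no number
of the β-function, no certificate, no binder INSTANCE.  The bubble ∕ jet part of the one-loop form is even under negation only JOINTLY with the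
source momentum (as for `ConjSymm₃`); that three-slot transport is NOT in this module.  Discharging `BetaPertH` would make Bałaban's ultraviolet
stability unconditional — NOT the continuum limit, NOT the Clay problem.  0 `sorry`, 0 cite tags.
-/

namespace Summit.QuantumFields.BalabanUV.Beta.VertexToriSymmetry

open Complex Set Matrix
open Literature.MathematicalPhysics.QuantumFieldTheory.Balaban1983to89
open Beta.AliasingTailL1 (StripRegularC)
open Summit.QuantumFields.BalabanUV.Beta.TubeMaximumModulus
open Summit.QuantumFields.BalabanUV.Beta.PolyRegularAlgebra (character)
open Summit.QuantumFields.BalabanUV.Beta.ConjReflectionAlgebra (conjNeg conjNeg_apply conjNeg_conjNeg ConjSymm MatConjSymm)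
open scoped Real ComplexConjugate Matrix.Norms.L2Operator

noncomputable section

variable {d : ℕ} {w : Fin (d + 1) → ℝ} {κ : ℝ}

/-! ## §1 Scalar integrands: transports and ENDs -/

section Instances

variable {E : Type*} [SeminormedAddCommGroup E] {G : (Fin (d + 1) → ℂ) → E} {M : ℝ}

/-- REFLECTION INVARIANCE of `G` in the directions `V` transports the norm bound. [folklore] -/
theorem transport_norm_reflect {V : Finset (Fin (d + 1))} (hG : ∀ ν ∈ V, ∀ q ∈ VertexTori w, G (reflectAt ν q) = G q) :
    ∀ ν ∈ V, ∀ q ∈ VertexTori w, ‖G q‖ ≤ M → ‖G (reflectAt ν q)‖ ≤ M :=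
  fun ν hν q hq h => by rw [hG ν hν q hq]; exact h

/-- EVENNESS `G (−q) = G q` transports the norm bound along negation. [folklore] -/
theorem transport_norm_neg (hG : ∀ q ∈ VertexTori w, G (-q) = G q) :
    ∀ q ∈ VertexTori w, ‖G q‖ ≤ M → ‖G (-q)‖ ≤ M :=
  fun q hq h => by rw [hG q hq]; exact h

/-- PERMUTATION INVARIANCE transports the norm bound. [folklore] -/
theorem transport_norm_permute
    (hG : ∀ σ : Equiv.Perm (Fin (d + 1)), ∀ q ∈ VertexTori (fun _ : Fin (d + 1) => κ), G (permute σ q) = G q) :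
    ∀ σ : Equiv.Perm (Fin (d + 1)), ∀ q ∈ VertexTori (fun _ : Fin (d + 1) => κ), ‖G q‖ ≤ M → ‖G (permute σ q)‖ ≤ M :=
  fun σ q hq h => by rw [hG σ q hq]; exact h

/-- **`ConjSymm` (kernel: `Beta/ConjReflectionAlgebra`) transports NORM BOUNDS along `conjNeg`**: `G(−q̄) = conj G(q)` and `‖conj z‖ = ‖z‖`. [folklore] -/
theorem transport_norm_conjNeg {F : (Fin (d + 1) → ℂ) → ℂ} (hF : ConjSymm F) {M : ℝ} :
    ∀ q ∈ VertexTori w, ‖F q‖ ≤ M → ‖F (conjNeg q)‖ ≤ M :=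
  fun q _ h => by rw [hF q, Complex.norm_conj]; exact h

/-- **`ConjSymm` transports ZERO-FREENESS along `conjNeg`** (the face data of a (Z1) certificate). [folklore] -/
theorem transport_ne_zero_conjNeg {F : (Fin (d + 1) → ℂ) → ℂ} (hF : ConjSymm F) :
    ∀ q ∈ VertexTori w, F q ≠ 0 → F (conjNeg q) ≠ 0 :=
  fun q _ h => by rw [hF q]; exact (map_ne_zero_iff _ (RingHom.injective _)).mpr h

/-- reflection invariance transports zero-freeness. [folklore] -/
theorem transport_ne_zero_reflect {F : (Fin (d + 1) → ℂ) → ℂ} {V : Finset (Fin (d + 1))}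
    (hF : ∀ ν ∈ V, ∀ q ∈ VertexTori w, F (reflectAt ν q) = F q) :
    ∀ ν ∈ V, ∀ q ∈ VertexTori w, F q ≠ 0 → F (reflectAt ν q) ≠ 0 :=
  fun ν hν q hq h => by rw [hF ν hν q hq]; exact h

/-- permutation invariance transports zero-freeness. [folklore] -/
theorem transport_ne_zero_permute {F : (Fin (d + 1) → ℂ) → ℂ}
    (hF : ∀ σ : Equiv.Perm (Fin (d + 1)), ∀ q ∈ VertexTori (fun _ : Fin (d + 1) => κ), F (permute σ q) = F q) :
    ∀ σ : Equiv.Perm (Fin (d + 1)), ∀ q ∈ VertexTori (fun _ : Fin (d + 1) => κ), F q ≠ 0 → F (permute σ q) ≠ 0 :=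
  fun σ q hq h => by rw [hF σ q hq]; exact h

/-- the ALL-PLUS TORUS `{|Re q_μ| ≤ π, Im q_μ = +w_μ ∀μ}` — ONE of the `2^{d+1}` vertex tori. [folklore] -/
def PlusTorus (w : Fin (d + 1) → ℝ) : Set (Fin (d + 1) → ℂ) := {p | ∀ μ, |(p μ).re| ≤ π ∧ (p μ).im = w μ}

/-- the all-plus torus is one of the vertex tori (for nonnegative half-widths). [folklore] -/
theorem plusTorus_subset_vertexTori (hw : ∀ μ, 0 ≤ w μ) : PlusTorus w ⊆ VertexTori w :=
  fun _ hp μ => ⟨(hp μ).1, by rw [(hp μ).2, abs_of_nonneg (hw μ)]⟩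

/-- **END (norm bound): REFLECTION INVARIANCE IN EVERY DIRECTION + a bound on the ONE all-plus torus ⟹ the bound on all `2^{d+1}` vertex
tori.** [folklore] -/
theorem norm_le_vertexTori_of_plusTorus (hG : ∀ ν, ∀ q ∈ VertexTori w, G (reflectAt ν q) = G q)
    (hM : ∀ p ∈ PlusTorus w, ‖G p‖ ≤ M) : ∀ p ∈ VertexTori w, ‖G p‖ ≤ M :=
  of_plusRegion (P := fun q => ‖G q‖ ≤ M) Finset.univ (transport_norm_reflect fun ν _ => hG ν)
    fun q hq hplus => hM q fun μ => ⟨(hq μ).1, hplus μ (Finset.mem_univ μ)⟩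

/-- **END (norm bound, half of one torus): reflections in every direction + `ConjSymm` + a bound on the HALF all-plus torus `Re q_{ν₀} ≤ 0`
⟹ the bound on all vertex tori.** [folklore] -/
theorem norm_le_vertexTori_of_halfPlusTorus {F : (Fin (d + 1) → ℂ) → ℂ} {M : ℝ} (ν₀ : Fin (d + 1))
    (hFr : ∀ ν, ∀ q ∈ VertexTori w, F (reflectAt ν q) = F q) (hFc : ConjSymm F)
    (hM : ∀ p ∈ PlusTorus w, (p ν₀).re ≤ 0 → ‖F p‖ ≤ M) : ∀ p ∈ VertexTori w, ‖F p‖ ≤ M := by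
  refine of_conjNegRegion (P := fun q => ‖F q‖ ≤ M) ν₀ (transport_norm_conjNeg hFc) ?_
  intro q hq hre
  -- on the half `Re q_{ν₀} ≤ 0` of ALL tori: reduce to the all-plus torus by reflections in the directions `≠ ν₀` … but a reflection at
  -- `ν ≠ ν₀` keeps `Re q_{ν₀}`, and at `ν₀` itself it flips its sign; so we reduce with the predicate strengthened by the half-space only
  -- through directions other than `ν₀`, and treat `ν₀` by `conjNeg ∘ reflectAt ν₀` (which keeps `Re q_{ν₀}` and flips `Im q_{ν₀}`).
  have key : ∀ p ∈ VertexTori w, (p ν₀).re ≤ 0 → ‖F p‖ ≤ M := by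
    -- step 1: all directions other than ν₀ made plus, under the side condition `Re p_{ν₀} ≤ 0`
    have h1 : ∀ p ∈ VertexTori w, ((p ν₀).re ≤ 0 ∧ (p ν₀).im = w ν₀) →
        ‖F p‖ ≤ M := by
      classical
      intro p hp hp0
      have := of_plusRegion (w := w) (P := fun q => ((q ν₀).re ≤ 0 ∧ (q ν₀).im = w ν₀) → ‖F q‖ ≤ M)
        (Finset.univ.erase ν₀) ?_ ?_ p hp hp0
      · exact this
      · intro ν hν q hq hPq hcond
        have hne : ν ≠ ν₀ := Finset.ne_of_mem_erase hν
        have hcond' : (q ν₀).re ≤ 0 ∧ (q ν₀).im = w ν₀ := by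
          rwa [reflectAt_apply_ne hne.symm] at hcond
        rw [hFr ν q hq]; exact hPq hcond'
      · intro q hq hplus hcond
        refine hM q (fun μ => ⟨(hq μ).1, ?_⟩) hcond.1
        by_cases hμ : μ = ν₀
        · rw [hμ]; exact hcond.2
        · exact hplus μ (Finset.mem_erase.mpr ⟨hμ, Finset.mem_univ μ⟩)
    -- step 2: the direction ν₀: if `Im p_{ν₀} = −w_{ν₀}`, apply `conjNeg ∘ reflectAt ν₀` (keeps `Re p_{ν₀}`, flips `Im p_{ν₀}`)
    intro p hp hre
    by_cases h0 : (p ν₀).im = w ν₀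
    · exact h1 p hp ⟨hre, h0⟩
    · have hneg := im_eq_neg_of_ne hp h0
      set p' := conjNeg (reflectAt ν₀ p) with hp'
      have hp'_mem : p' ∈ VertexTori w := conjNeg_mem_vertexTori (reflectAt_mem_vertexTori ν₀ hp)
      have hp'_re : (p' ν₀).re = (p ν₀).re := by rw [hp', conjNeg_re, reflectAt_apply_same, neg_re, neg_neg]
      have hp'_im : (p' ν₀).im = w ν₀ := by rw [hp', conjNeg_im, reflectAt_apply_same, neg_im, hneg, neg_neg]
      have hb := h1 p' hp'_mem ⟨by rw [hp'_re]; exact hre, hp'_im⟩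
      -- transport back: `F p' = conj (F (reflectAt ν₀ p)) = conj (F p)`
      rw [hp', hFc, Complex.norm_conj, hFr ν₀ p hp] at hb
      exact hb
  exact key q hq hre

end Instances

section Ends

variable {G : (Fin (d + 1) → ℂ) → ℂ} {M : ℝ}

/-- **END INTO THE FACE THEOREM**: `TubeHol G w` + reflection invariance in every direction + a bound on the all-plus torus ⟹ the bound on the
whole closed tube (`TubeHol.norm_le_of_vertexTori`). [folklore] -/
theorem TubeHol.norm_le_of_plusTorus (h : TubeHol G w) (hG : ∀ ν, ∀ q ∈ VertexTori w, G (reflectAt ν q) = G q)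
    (hM : ∀ p ∈ PlusTorus w, ‖G p‖ ≤ M) : ∀ p ∈ Tube w, ‖G p‖ ≤ M :=
  h.norm_le_of_vertexTori (norm_le_vertexTori_of_plusTorus hG hM)

/-- **BINDER FORM**: `TubeHol G κ` + reflection invariance in every direction + a certified bound `M` on the ONE torus `Im q = κ·(1,…,1)` ⟹
the cell's binder `StripRegularC G κ M`. [folklore] -/
theorem TubeHol.stripRegularC_of_plusTorus (h : TubeHol G (fun _ : Fin (d + 1) => κ))
    (hG : ∀ ν, ∀ q ∈ VertexTori (fun _ : Fin (d + 1) => κ), G (reflectAt ν q) = G q)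
    (hM : ∀ p ∈ PlusTorus (fun _ : Fin (d + 1) => κ), ‖G p‖ ≤ M) : StripRegularC G κ M :=
  h.stripRegularC_of_vertexTori (norm_le_vertexTori_of_plusTorus hG hM)

/-- **BINDER FORM, fully symmetric case** (cap3's (P)(R)(C)): `TubeHol G κ` + reflection and permutation invariance + `ConjSymm G` + a
certified bound `M` on CAP-KERNEL §4.8 (2)'s fundamental region `CapRegion κ` ⟹ `StripRegularC G κ M`. [folklore] -/
theorem TubeHol.stripRegularC_of_capRegion (h : TubeHol G (fun _ : Fin (d + 1) => κ))
    (hGr : ∀ ν, ∀ q ∈ VertexTori (fun _ : Fin (d + 1) => κ), G (reflectAt ν q) = G q)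
    (hGσ : ∀ σ : Equiv.Perm (Fin (d + 1)), ∀ q ∈ VertexTori (fun _ : Fin (d + 1) => κ), G (permute σ q) = G q)
    (hGc : ConjSymm G)
    (hM : ∀ p ∈ VertexTori (fun _ : Fin (d + 1) => κ), CapRegion κ p → ‖G p‖ ≤ M) : StripRegularC G κ M :=
  h.stripRegularC_of_vertexTori
    (of_capRegion (P := fun q => ‖G q‖ ≤ M)
      (fun ν => transport_norm_reflect (V := Finset.univ) (fun ν _ => hGr ν) ν (Finset.mem_univ ν))
      (transport_norm_permute hGσ) (transport_norm_conjNeg hGc) hM)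

end Ends

/-! ## §2 Matrix families in the Euclidean operator norm -/

section MatrixNorms

open WithLp

variable {n : Type*} [Fintype n] [DecidableEq n]

omit [DecidableEq n] in
/-- entrywise conjugation versus the matrix action: `Ā v = conj (A v̄)`. [folklore] -/
theorem map_conj_mulVec (A : Matrix n n ℂ) (v : n → ℂ) : (A.map conj) *ᵥ v = star (A *ᵥ star v) := by
  ext i; simp [Matrix.mulVec, dotProduct]

omit [DecidableEq n] in
/-- conjugating the entries of a vector of `ℂⁿ` preserves its Euclidean norm. [folklore] -/
theorem norm_toLp_star (u : n → ℂ) : ‖(toLp 2 (star u) : EuclideanSpace ℂ n)‖ = ‖(toLp 2 u : EuclideanSpace ℂ n)‖ := by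
  simp [EuclideanSpace.norm_eq]

/-- `‖A.map conj‖₂ ≤ ‖A‖₂`. [folklore] -/
theorem l2_opNorm_map_conj_le (A : Matrix n n ℂ) : ‖A.map conj‖ ≤ ‖A‖ := by
  rw [Matrix.l2_opNorm_def (A.map conj)]
  refine ContinuousLinearMap.opNorm_le_bound _ (norm_nonneg _) fun y => ?_
  change ‖(toLp 2 ((A.map conj) *ᵥ ofLp y) : EuclideanSpace ℂ n)‖ ≤ ‖A‖ * ‖y‖
  rw [map_conj_mulVec, norm_toLp_star]
  have h := Matrix.l2_opNorm_mulVec A (toLp 2 (star (ofLp y)) : EuclideanSpace ℂ n)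
  have e : ‖(toLp 2 (star (ofLp y)) : EuclideanSpace ℂ n)‖ = ‖y‖ := by rw [norm_toLp_star]
  rw [e] at h
  exact h

/-- **`‖A.map conj‖₂ = ‖A‖₂`** (the Euclidean operator norm is invariant under entrywise conjugation). [folklore] -/
theorem l2_opNorm_map_conj (A : Matrix n n ℂ) : ‖A.map conj‖ = ‖A‖ := by
  refine le_antisymm (l2_opNorm_map_conj_le A) ?_
  have h := l2_opNorm_map_conj_le (A.map conj)
  have e : (A.map conj).map conj = A := by ext i j; simp
  rwa [e] at h

/-- **`‖Aᵀ‖₂ = ‖A‖₂`** (transpose = conjugate transpose after entrywise conjugation; Mathlib's `Matrix.l2_opNorm_conjTranspose`). [folklore] -/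
theorem l2_opNorm_transpose (A : Matrix n n ℂ) : ‖Aᵀ‖ = ‖A‖ := by
  have e : Aᵀ = (Aᴴ).map conj := by ext i j; simp
  rw [e, l2_opNorm_map_conj, Matrix.l2_opNorm_conjTranspose]

variable {A B : (Fin (d + 1) → ℂ) → Matrix n n ℂ}

/-- `MatConjSymm A` ⟹ the operator norm is `conjNeg`-invariant: `‖A(−q̄)‖₂ = ‖A(q)‖₂`. [folklore] -/
theorem matConjSymm_opNorm_conjNeg (hA : MatConjSymm A) (q : Fin (d + 1) → ℂ) : ‖A (conjNeg q)‖ = ‖A q‖ := by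
  rw [hA q, l2_opNorm_map_conj]

/-- `MatConjSymm A` ⟹ the RESOLVENT norm is `conjNeg`-invariant: `‖A(−q̄)⁻¹‖₂ = ‖A(q)⁻¹‖₂`. [folklore] -/
theorem matConjSymm_invNorm_conjNeg (hA : MatConjSymm A) (q : Fin (d + 1) → ℂ) : ‖(A (conjNeg q))⁻¹‖ = ‖(A q)⁻¹‖ := by
  have h := matConjSymm_opNorm_conjNeg (A := fun p => (A p)⁻¹) (MatConjSymm.inv hA) q
  simpa only using h

/-- hence the `conjNeg` TRANSPORT of route A's binder `‖(A q)⁻¹‖ ≤ B` — dischargeable today for character sums over self-conjugate tables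
(`ConjReflectionAlgebra.matConjSymm_characterSum`). [folklore] -/
theorem transport_invNorm_conjNeg (hA : MatConjSymm A) {B : ℝ} :
    ∀ q ∈ VertexTori w, ‖(A q)⁻¹‖ ≤ B → ‖(A (conjNeg q))⁻¹‖ ≤ B :=
  fun q _ h => by rw [matConjSymm_invNorm_conjNeg hA q]; exact h

/-- NEGATION-TRANSPOSE SYMMETRY of a matrix family: `A (−q) = (A q)ᵀ` — what a stencil family `q ↦ Σ_R e^{iq·R} K[R]` with `K[−R] = K[R]ᵀ` satisfies. [folklore] -/
def MatNegTranspose (A : (Fin (d + 1) → ℂ) → Matrix n n ℂ) : Prop := ∀ q, A (-q) = (A q)ᵀ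

omit [Fintype n] [DecidableEq n] in
/-- a character at `−q` is the character of the opposite frequency at `q`. [folklore] -/
theorem character_neg (x : Fin (d + 1) → ℤ) (q : Fin (d + 1) → ℂ) : character x (-q) = character (-x) q := by
  unfold character
  congr 1
  simp only [Pi.neg_apply, Int.cast_neg, mul_neg, neg_mul, Finset.sum_neg_distrib]

omit [Fintype n] [DecidableEq n] in
/-- **TABLE SYMMETRY ⟹ `MatNegTranspose`**: a stencil family over an offset set closed under `R ↦ −R` whose tables satisfy `K[−R] = K[R]ᵀ` has
`A(−q) = A(q)ᵀ`. [folklore] -/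
theorem matNegTranspose_characterSum (S : Finset (Fin (d + 1) → ℤ)) (K : (Fin (d + 1) → ℤ) → Matrix n n ℂ)
    (hS : ∀ x ∈ S, -x ∈ S) (hK : ∀ x ∈ S, K (-x) = (K x)ᵀ) :
    MatNegTranspose (fun p => ∑ x ∈ S, character x p • K x) := by
  intro q
  simp only [character_neg]
  rw [Matrix.transpose_sum]
  refine Finset.sum_bij' (fun x _ => -x) (fun x _ => -x) (fun x hx => hS x hx) (fun x hx => hS x hx)
    (fun x _ => neg_neg x) (fun x _ => neg_neg x) (fun x hx => ?_)
  rw [Matrix.transpose_smul, hK x hx, Matrix.transpose_transpose]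

/-- `MatNegTranspose` ⟹ the operator norm is even: `‖A(−q)‖₂ = ‖A(q)‖₂`. [folklore] -/
theorem matNegTranspose_opNorm_neg (hA : MatNegTranspose A) (q : Fin (d + 1) → ℂ) : ‖A (-q)‖ = ‖A q‖ := by
  rw [hA q, l2_opNorm_transpose]

/-- `MatNegTranspose` passes to the inverse family: `A(−q)⁻¹ = (A(q)⁻¹)ᵀ`. [folklore] -/
theorem matNegTranspose_inv_apply (hA : MatNegTranspose A) (q : Fin (d + 1) → ℂ) : (A (-q))⁻¹ = ((A q)⁻¹)ᵀ := by
  rw [hA q, Matrix.transpose_nonsing_inv]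

/-- `MatNegTranspose` passes to the inverse family. [folklore] -/
theorem matNegTranspose_inv (hA : MatNegTranspose A) : MatNegTranspose (fun q => (A q)⁻¹) :=
  fun q => matNegTranspose_inv_apply hA q

/-- `MatNegTranspose` ⟹ the RESOLVENT norm is even: `‖A(−q)⁻¹‖₂ = ‖A(q)⁻¹‖₂`. [folklore] -/
theorem matNegTranspose_invNorm_neg (hA : MatNegTranspose A) (q : Fin (d + 1) → ℂ) : ‖(A (-q))⁻¹‖ = ‖(A q)⁻¹‖ := by
  rw [matNegTranspose_inv_apply hA q, l2_opNorm_transpose]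

/-- hence the NEGATION TRANSPORT of route A's binder `‖(A q)⁻¹‖ ≤ B` (sign patterns `s` and `−s` identified, `of_negRegion`). [folklore] -/
theorem transport_invNorm_neg (hA : MatNegTranspose A) {B : ℝ} :
    ∀ q ∈ VertexTori w, ‖(A q)⁻¹‖ ≤ B → ‖(A (-q))⁻¹‖ ≤ B :=
  fun q _ h => by rw [matNegTranspose_invNorm_neg hA q]; exact h

/-- **EVENNESS OF THE TADPOLE TRACE**: `MatNegTranspose A`, `MatNegTranspose B` ⟹ `tr(A(−q)⁻¹ B(−q)) = tr(A(q)⁻¹ B(q))`. [folklore] -/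
theorem trace_resolvent_neg (hA : MatNegTranspose A) (hB : MatNegTranspose B) (q : Fin (d + 1) → ℂ) :
    ((A (-q))⁻¹ * B (-q)).trace = ((A q)⁻¹ * B q).trace := by
  rw [matNegTranspose_inv_apply hA q, hB q, ← Matrix.transpose_mul, Matrix.trace_transpose, Matrix.trace_mul_comm]

/-- END: the resolvent-norm binder on all vertex tori from its values on the tori with `Im q_{ν₀} = +w_{ν₀}`, for a family with the table
symmetry `A(−q) = A(q)ᵀ`. [folklore] -/
theorem invNorm_le_vertexTori_of_negRegion (hA : MatNegTranspose A) {B : ℝ} (ν₀ : Fin (d + 1))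
    (hreg : ∀ q ∈ VertexTori w, (q ν₀).im = w ν₀ → ‖(A q)⁻¹‖ ≤ B) : ∀ q ∈ VertexTori w, ‖(A q)⁻¹‖ ≤ B :=
  of_negRegion (P := fun q => ‖(A q)⁻¹‖ ≤ B) ν₀ (transport_invNorm_neg hA) hreg

/-- END: … and additionally from the HALF `Re q_{ν₁} ≤ 0` of those tori, for a family that is also `MatConjSymm`. [folklore] -/
theorem invNorm_le_vertexTori_of_negConjRegion (hA : MatNegTranspose A) (hA' : MatConjSymm A) {B : ℝ} (ν₀ ν₁ : Fin (d + 1))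
    (hreg : ∀ q ∈ VertexTori w, (q ν₀).im = w ν₀ → (q ν₁).re ≤ 0 → ‖(A q)⁻¹‖ ≤ B) :
    ∀ q ∈ VertexTori w, ‖(A q)⁻¹‖ ≤ B := by
  refine invNorm_le_vertexTori_of_negRegion hA ν₀ ?_
  -- on the tori with `Im q_{ν₀} = +w_{ν₀}`: `conjNeg` keeps imaginary parts, so the half-torus reduction applies inside this class
  intro q hq h0
  exact of_conjNegRegion (P := fun q => (q ν₀).im = w ν₀ → ‖(A q)⁻¹‖ ≤ B) ν₁
    (fun q _ hPq him => by
      rw [matConjSymm_invNorm_conjNeg hA' q]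
      exact hPq (by simpa [conjNeg_apply] using him))
    (fun q hq hre him => hreg q hq him hre) q hq h0

end MatrixNorms

end

end Summit.QuantumFields.BalabanUV.Beta.VertexToriSymmetry
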